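import Literature.NumberTheory.Rogawski1990.RankOneUnstableEventualConstancy   -- ★ p843155 F0P3-p01 (g13): the INERT LAYER 2a `exists_eventually_mul_eq_const_of_depthExpansion` (same binder shapes; brings Mathlib topology∕filters∕big operators)
import HarnessLib

/-!
# (R1-core) at a RAMIFIED place, LAYER 2a-ram — EVENTUAL CONSTANCY of `Δ(t)·(O(t) − O(t′))` near the singular sub-torus from a SIGNED depth expansion whose sign SQUARES AWAY
# against the transfer factor's sign, and a two-step (`N ↦ N + 2`) normalisation (road «R1LL-tree», ramified branch R-5b; Rogawski 1990 Lemma 4.9.3; Labesse–Langlands 1979 §2, ramified `T`)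

Topic `NumberTheory/Rogawski1990`; namespace `Literature.NumberTheory.Rogawski1990`.  THEOREMS ONLY (no definition, no instance, no notation, no named fact, no `sorry`);
ABSTRACT over a topological space `X` (the compact torus `Z(t₀)`), its regular locus `U`, a depth `N : X → ℕ` and complex-valued data — the ramified twin of ★ p843155
`exists_eventually_mul_eq_const_of_depthExpansion` (F0P3-p01 (g13), LAYER 2a).  Cell `pub/hodgecm-mathlib`, crux H413 = `stmt-HodgeConjecture-24833`, line «N6nsGerm» stub
`stub_N6nsR1LL`; architect A-p16 (g27) RULING A-19 (R5b-β) «ramified L2a-algebra + assembly + head … statement-first skeleton → F0P3a-p03 (g12)»; designer of record for the ramified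
expansion (R5b-α) = B-p12 (g29) (census `CENSUS-R1LL-tameRamified-LocalClass` (N1)–(N5), A-19), `Δ`-value = B-p10 (g26) ★ p843425 (R-4).

WHAT THE RAMIFIED ROAD DELIVERS (B-p12 (N2)(N4)(N5) ∕ B-p10 R-4 ∕ MEMO-R1ram §4, in the shape consumed here).  At a singular point `s` of the torus (`N t → ∞` along `U`, `N t` of a
FIXED PARITY `p` near `s` — odd at a ramified place):
* (R5b-α, `hD`) for `t ∈ U` with `m ≤ N t`: `D t = sg t · Σ_{i<m} A i (N t) · ψ i t` — ONLY the window depths `i < m` survive (the deep facets carry the scalar class, killed by the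
  `η`-antisymmetrisation (N1)), with the ANGLE SIGN `sg t` (`= (b₀(t), θ)_v` ∕ `ω_v(−f_t)`), SIGNED depth counts `A i n` (`J_i(n)`) depending on `t` only through `n = N t`, and window values
  `ψ i t = φ(c_t(1 + ϖ^i n₁)) − φ(c_t(1 + ϖ^i n_η))` eventually constant at `s`;
* (R-4, `hΔ`) for `t ∈ U` with `N₁ ≤ N t`: `Δ t = E t · (sg′ t · B (N t))` with `E` eventually constant at `s` (`μ_v(τ₁ t)⁻¹·C⁻¹`), the factor's own sign `sg′ t` and a pure depth
  factor `B n` (`q^{−(n−1)∕2}(√q)⁻¹`-type);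
* (S5) «THE TWO SIGNS SQUARE AWAY»: `sg′ t · sg t = σ₀` on `U` (★ `hilbertSymbol_mul_self_eq_one`);
* (N5) TWO-STEP NORMALISATION: `B n · A i n = C i` for all `n ≥ n₀` of parity `p` — from the recursions `A i (n+2) = a·A i n` (`a = ω_v(−1)·q`), `B (n+2) = b·B n`, `b·a = 1`
  (`mul_eq_of_two_step_recursion` below does this bookkeeping once).
THEN `Δ t · D t` is EVENTUALLY CONSTANT at `s` along `U` (`exists_eventually_mul_eq_const_of_signedExpansion`), with the constant `E s · σ₀ · Σ_{i<m} C i · ψ i s`.  THE DESIGNER'S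
FOLDED SHAPE (B-p12 MEMO (R5b-α) (7): `D t = ε t·b^{(N t−1)∕2}·Ψ t`, `Δ t·ε t = E t·(b^{(N t−1)∕2})⁻¹`, `b = s₀q ≠ 0`) is `exists_eventually_mul_eq_const_of_signedWindow` (+ `forall_…`,
+ `eventually_windowSum_eq` feeding `hΨ` from per-depth constancy); together with the
regular-point local constancy `hreg` (★ p843384, place-agnostic) this is the `hEv` binder of ★ L1 `rankOneUnstable_core_inert_of_eventually` (place-agnostic, A-19) at a ramified `v`.
HONEST LABEL: HC_CM is proved only modulo the printed citations (2 remaining named inputs hLiu418, h413) until rung 0 closes; pure bookkeeping — the arithmetic content is in the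
hypotheses `hD`, `hΔ`, `hss`, `hAB`, which the ramified bricks R-2∕R-3∕R-4∕(R5b-α) discharge.

## References
* [Rogawski1990] J. D. Rogawski, *Automorphic Representations of Unitary Groups in Three Variables*, Ann. of Math. Stud. 123 (1990): §4.9 Lemma 4.9.3 (4.9.2) p. 56.
* [LabesseLanglands1979] J.-P. Labesse, R. P. Langlands, *L-indistinguishability for SL(2)*, Canad. J. Math. 31 (1979): §2 (the ramified torus: `δ_m = 2q^m`, the sign of the angle).
-/

set_option autoImplicit false

open Filter Topology Finset

namespace Literature.NumberTheory.Rogawski1990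

/-! ## §1 Two-step recursions: `B n · A n` is constant along a parity class -/

section TwoStep

variable {R : Type*} [CommRing R]

/-- **Two-step recursions with reciprocal ratios have a product constant along each parity class**: if `A (n+2) = a·A n` and `B (n+2) = b·B n` for `n ≥ n₀` and `b·a = 1`, then
`B (n + 2k)·A (n + 2k) = B n·A n` for `n ≥ n₀` (the signed depth counts `J_i(N+2) = ω_v(−1)q·J_i(N)` against the factor `q^{−N∕2}μ_w(ϖ)^{−N}`).
[cite: LabesseLanglands1979, §2] [cite: Rogawski1990, §4.9 Lemma 4.9.3 (4.9.2) p. 56] -/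
theorem mul_eq_mul_of_two_step_recursion (A B : ℕ → R) {a b : R} {n₀ : ℕ} (hA : ∀ n, n₀ ≤ n → A (n + 2) = a * A n)
    (hB : ∀ n, n₀ ≤ n → B (n + 2) = b * B n) (hab : b * a = 1) (n : ℕ) (hn : n₀ ≤ n) (k : ℕ) :
    B (n + 2 * k) * A (n + 2 * k) = B n * A n := by
  induction k with
  | zero => simp
  | succ k ih =>
    have hle : n₀ ≤ n + 2 * k := hn.trans (Nat.le_add_right n (2 * k))
    have h1 : n + 2 * (k + 1) = (n + 2 * k) + 2 := by ring
    rw [h1, hA _ hle, hB _ hle, ← ih]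
    calc b * B (n + 2 * k) * (a * A (n + 2 * k)) = (b * a) * (B (n + 2 * k) * A (n + 2 * k)) := by ring
      _ = B (n + 2 * k) * A (n + 2 * k) := by rw [hab, one_mul]

/-- **Parity-class form**: under the same recursions, `B n·A n = B n₁·A n₁` whenever `n₀ ≤ n₁ ≤ n` and `n ≡ n₁ (mod 2)`. [cite: LabesseLanglands1979, §2] -/
theorem mul_eq_mul_of_two_step_recursion_of_mod_two_eq (A B : ℕ → R) {a b : R} {n₀ : ℕ} (hA : ∀ n, n₀ ≤ n → A (n + 2) = a * A n)
    (hB : ∀ n, n₀ ≤ n → B (n + 2) = b * B n) (hab : b * a = 1) {n₁ n : ℕ} (hn₁ : n₀ ≤ n₁) (hn : n₁ ≤ n) (hpar : n % 2 = n₁ % 2) :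
    B n * A n = B n₁ * A n₁ := by
  obtain ⟨d, rfl⟩ := Nat.exists_eq_add_of_le hn
  have hd : d % 2 = 0 := by omega
  obtain ⟨k, hk⟩ := Nat.dvd_of_mod_eq_zero hd
  rw [hk]
  exact mul_eq_mul_of_two_step_recursion A B hA hB hab n₁ hn₁ k

/-- **The normalisation hypothesis `hAB` from the recursions**: `B n·A i n = B n₁·A i n₁ =: C i` for every window depth `i < m` and every `n ≥ n₁ ≥ n₀` of the parity of `n₁`.
[cite: LabesseLanglands1979, §2] -/
theorem forall_mul_eq_of_two_step_recursion (m : ℕ) (A : ℕ → ℕ → R) (B : ℕ → R) {a b : R} {n₀ n₁ : ℕ} (hn₁ : n₀ ≤ n₁)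
    (hA : ∀ i ∈ range m, ∀ n, n₀ ≤ n → A i (n + 2) = a * A i n) (hB : ∀ n, n₀ ≤ n → B (n + 2) = b * B n) (hab : b * a = 1) :
    ∀ n, n₁ ≤ n → n % 2 = n₁ % 2 → ∀ i ∈ range m, B n * A i n = B n₁ * A i n₁ :=
  fun _ hn hpar i hi => mul_eq_mul_of_two_step_recursion_of_mod_two_eq (A i) B (hA i hi) hB hab hn₁ hn hpar

end TwoStep

/-! ## §2 Eventual constancy at a singular point from the signed expansion -/

section EventualConstancy

variable {X : Type*} [TopologicalSpace X]

/-- **EVENTUAL CONSTANCY AT A SINGULAR POINT, RAMIFIED SHAPE.**  See the module docstring: with the signed window expansion `hD`, the `Δ`-value `hΔ`, the sign cancellation `hss`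
and the two-step normalisation `hAB` (parity `p` of the depth near `s`), `∃ c, ∀ᶠ t in 𝓝 s, t ∈ U → Δ t * D t = c`; the constant is `E s · σ₀ · Σ_{i<m} C i · ψ i s`.
[cite: Rogawski1990, §4.9 Lemma 4.9.3 (4.9.2) p. 56] [cite: LabesseLanglands1979, §2] -/
theorem exists_eventually_mul_eq_const_of_signedExpansion {U : Set X} (s : X) (m N₁ n₀ p : ℕ)
    (N : X → ℕ) (D Δ E sg sg' : X → ℂ) (ψ : ℕ → X → ℂ) (A : ℕ → ℕ → ℂ) (B : ℕ → ℂ) (σ₀ : ℂ) (C : ℕ → ℂ)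
    (hN : ∀ M : ℕ, ∀ᶠ t in 𝓝 s, t ∈ U → M ≤ N t) (hNpar : ∀ᶠ t in 𝓝 s, t ∈ U → N t % 2 = p)
    (hE : ∀ᶠ t in 𝓝 s, t ∈ U → E t = E s) (hψ : ∀ i ∈ range m, ∀ᶠ t in 𝓝 s, t ∈ U → ψ i t = ψ i s)
    (hD : ∀ t ∈ U, m ≤ N t → D t = sg t * ∑ i ∈ range m, A i (N t) * ψ i t)
    (hΔ : ∀ t ∈ U, N₁ ≤ N t → Δ t = E t * (sg' t * B (N t)))
    (hss : ∀ t ∈ U, sg' t * sg t = σ₀)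
    (hAB : ∀ n, n₀ ≤ n → n % 2 = p → ∀ i ∈ range m, B n * A i n = C i) :
    ∃ c : ℂ, ∀ᶠ t in 𝓝 s, t ∈ U → Δ t * D t = c := by
  refine ⟨E s * σ₀ * ∑ i ∈ range m, C i * ψ i s, ?_⟩
  have hψ' : ∀ᶠ t in 𝓝 s, t ∈ U → ∀ i ∈ range m, ψ i t = ψ i s := by
    have h := (Finset.eventually_all (range m)).2 fun i hi => hψ i hi
    exact h.mono fun t ht htU i hi => ht i hi htU
  filter_upwards [hN (max m (max N₁ n₀)), hNpar, hE, hψ'] with t htN htp htE htψ htU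
  have hmN : m ≤ N t := (le_max_left _ _).trans (htN htU)
  have hN₁ : N₁ ≤ N t := ((le_max_left _ _).trans (le_max_right _ _)).trans (htN htU)
  have hn₀ : n₀ ≤ N t := ((le_max_right _ _).trans (le_max_right _ _)).trans (htN htU)
  have hC : ∀ i ∈ range m, B (N t) * A i (N t) = C i := hAB (N t) hn₀ (htp htU)
  rw [hΔ t htU hN₁, hD t htU hmN, htE htU]
  calc E s * (sg' t * B (N t)) * (sg t * ∑ i ∈ range m, A i (N t) * ψ i t)
      = E s * (sg' t * sg t) * ∑ i ∈ range m, (B (N t) * A i (N t)) * ψ i t := by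
        rw [Finset.mul_sum, Finset.mul_sum, Finset.mul_sum]
        refine Finset.sum_congr rfl fun i _ => by ring
    _ = E s * σ₀ * ∑ i ∈ range m, C i * ψ i s := by
        rw [hss t htU]
        congr 1
        exact Finset.sum_congr rfl fun i hi => by rw [hC i hi, htψ htU i hi]

/-- **`hEv` ASSEMBLED on all of `X`, ramified shape**: at the points of `U` eventual constancy is given directly (`hreg`), at the points outside `U` it is the previous theorem.
[cite: Rogawski1990, §4.9 Lemma 4.9.3 (4.9.2) p. 56] [cite: LabesseLanglands1979, §2] -/
theorem forall_exists_eventually_mul_eq_const_of_signedExpansion {U : Set X} (m N₁ n₀ p : ℕ)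
    (N : X → ℕ) (D Δ E sg sg' : X → ℂ) (ψ : ℕ → X → ℂ) (A : ℕ → ℕ → ℂ) (B : ℕ → ℂ) (σ₀ : ℂ) (C : ℕ → ℂ)
    (hreg : ∀ s ∈ U, ∃ c : ℂ, ∀ᶠ t in 𝓝 s, t ∈ U → Δ t * D t = c)
    (hN : ∀ s ∉ U, ∀ M : ℕ, ∀ᶠ t in 𝓝 s, t ∈ U → M ≤ N t) (hNpar : ∀ s ∉ U, ∀ᶠ t in 𝓝 s, t ∈ U → N t % 2 = p)
    (hE : ∀ s ∉ U, ∀ᶠ t in 𝓝 s, t ∈ U → E t = E s) (hψ : ∀ s ∉ U, ∀ i ∈ range m, ∀ᶠ t in 𝓝 s, t ∈ U → ψ i t = ψ i s)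
    (hD : ∀ t ∈ U, m ≤ N t → D t = sg t * ∑ i ∈ range m, A i (N t) * ψ i t)
    (hΔ : ∀ t ∈ U, N₁ ≤ N t → Δ t = E t * (sg' t * B (N t)))
    (hss : ∀ t ∈ U, sg' t * sg t = σ₀)
    (hAB : ∀ n, n₀ ≤ n → n % 2 = p → ∀ i ∈ range m, B n * A i n = C i) :
    ∀ s : X, ∃ c : ℂ, ∀ᶠ t in 𝓝 s, t ∈ U → Δ t * D t = c := by
  intro s
  by_cases hs : s ∈ U
  · exact hreg s hs
  · exact exists_eventually_mul_eq_const_of_signedExpansion s m N₁ n₀ p N D Δ E sg sg' ψ A B σ₀ C (hN s hs) (hNpar s hs) (hE s hs) (hψ s hs) hD hΔ hss hAB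

/-- **THE DESIGNER'S SHAPE (B-p12 (g29) MEMO (R5b-α) (7), `MEMO-R5b-alpha-RamifiedDepthExpansion` 06d3de01): one folded window sum `Ψ`, one sign `ε` put on `Δ`'s side.**
With `b = s₀q` (`s₀ = ω(−1)`): if for `t ∈ U` deep enough `D t = ε t · b^{(N t − 1)∕2} · Ψ t` ((5): `Ψ t = 2s₀ Σ_{i<m} (s₀∕q)^{⌊i∕2⌋} ψ_i t`, `ε = ε₀`) and
`Δ t · ε t = E t · (b^{(N t − 1)∕2})⁻¹` ((6): `E = E′`, the `t`-free product `E′ε₀` absorbed), with `Ψ`, `E` eventually constant at `s` along `U` and `N t → ∞`, then `Δ·D` is eventually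
constant at `s` (`= E s · Ψ s`): `Δ·D = (Δ·ε)·b^k·Ψ = E·(b^k)⁻¹·b^k·Ψ` — no telescoping brick, no parity bookkeeping (`b ≠ 0`). [cite: Rogawski1990, §4.9 Lemma 4.9.3 (4.9.2) p. 56] [cite: LabesseLanglands1979, §2] -/
theorem exists_eventually_mul_eq_const_of_signedWindow {U : Set X} (s : X) (m N₁ : ℕ) (N : X → ℕ) (D Δ E ε Ψ : X → ℂ) {b : ℂ} (hb : b ≠ 0)
    (hN : ∀ M : ℕ, ∀ᶠ t in 𝓝 s, t ∈ U → M ≤ N t)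
    (hE : ∀ᶠ t in 𝓝 s, t ∈ U → E t = E s) (hΨ : ∀ᶠ t in 𝓝 s, t ∈ U → Ψ t = Ψ s)
    (hD : ∀ t ∈ U, m ≤ N t → D t = ε t * b ^ ((N t - 1) / 2) * Ψ t)
    (hΔ : ∀ t ∈ U, N₁ ≤ N t → Δ t * ε t = E t * (b ^ ((N t - 1) / 2))⁻¹) :
    ∃ c : ℂ, ∀ᶠ t in 𝓝 s, t ∈ U → Δ t * D t = c := by
  refine ⟨E s * Ψ s, ?_⟩
  filter_upwards [hN (max m N₁), hE, hΨ] with t htN htE htΨ htU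
  have hmN : m ≤ N t := (le_max_left _ _).trans (htN htU)
  have hN₁ : N₁ ≤ N t := (le_max_right _ _).trans (htN htU)
  have hbk : b ^ ((N t - 1) / 2) ≠ 0 := pow_ne_zero _ hb
  rw [hD t htU hmN, ← htE htU, ← htΨ htU]
  calc Δ t * (ε t * b ^ ((N t - 1) / 2) * Ψ t) = (Δ t * ε t) * b ^ ((N t - 1) / 2) * Ψ t := by ring
    _ = E t * (b ^ ((N t - 1) / 2))⁻¹ * b ^ ((N t - 1) / 2) * Ψ t := by rw [hΔ t htU hN₁]
    _ = E t * Ψ t := by rw [mul_assoc (E t), inv_mul_cancel₀ hbk, mul_one]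

/-- `hEv` assembled on all of `X` in the designer's shape (regular points by `hreg`, singular points by `exists_eventually_mul_eq_const_of_signedWindow`).
[cite: Rogawski1990, §4.9 Lemma 4.9.3 (4.9.2) p. 56] [cite: LabesseLanglands1979, §2] -/
theorem forall_exists_eventually_mul_eq_const_of_signedWindow {U : Set X} (m N₁ : ℕ) (N : X → ℕ) (D Δ E ε Ψ : X → ℂ) {b : ℂ} (hb : b ≠ 0)
    (hreg : ∀ s ∈ U, ∃ c : ℂ, ∀ᶠ t in 𝓝 s, t ∈ U → Δ t * D t = c)
    (hN : ∀ s ∉ U, ∀ M : ℕ, ∀ᶠ t in 𝓝 s, t ∈ U → M ≤ N t)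
    (hE : ∀ s ∉ U, ∀ᶠ t in 𝓝 s, t ∈ U → E t = E s) (hΨ : ∀ s ∉ U, ∀ᶠ t in 𝓝 s, t ∈ U → Ψ t = Ψ s)
    (hD : ∀ t ∈ U, m ≤ N t → D t = ε t * b ^ ((N t - 1) / 2) * Ψ t)
    (hΔ : ∀ t ∈ U, N₁ ≤ N t → Δ t * ε t = E t * (b ^ ((N t - 1) / 2))⁻¹) :
    ∀ s : X, ∃ c : ℂ, ∀ᶠ t in 𝓝 s, t ∈ U → Δ t * D t = c := by
  intro s
  by_cases hs : s ∈ U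
  · exact hreg s hs
  · exact exists_eventually_mul_eq_const_of_signedWindow s m N₁ N D Δ E ε Ψ hb (hN s hs) (hE s hs) (hΨ s hs) hD hΔ

/-- **The window sum is eventually constant when its `m` summands are** (`Ψ t = κ · Σ_{i<m} w i · ψ i t` with `t`-free weights; feeds `hΨ` from the per-depth `hψ` of the torus pack).
[cite: LabesseLanglands1979, §2] -/
theorem eventually_windowSum_eq {U : Set X} (s : X) (m : ℕ) (κ : ℂ) (w : ℕ → ℂ) (ψ : ℕ → X → ℂ)
    (hψ : ∀ i ∈ range m, ∀ᶠ t in 𝓝 s, t ∈ U → ψ i t = ψ i s) :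
    ∀ᶠ t in 𝓝 s, t ∈ U → κ * ∑ i ∈ range m, w i * ψ i t = κ * ∑ i ∈ range m, w i * ψ i s := by
  have hψ' : ∀ᶠ t in 𝓝 s, t ∈ U → ∀ i ∈ range m, ψ i t = ψ i s := by
    have h := (Finset.eventually_all (range m)).2 fun i hi => hψ i hi
    exact h.mono fun t ht htU i hi => ht i hi htU
  filter_upwards [hψ'] with t ht htU
  rw [Finset.sum_congr rfl fun i hi => by rw [ht htU i hi]]

end EventualConstancy

/-! ## §3 (ED. 2) The folding algebra of the designer's display (B-p12 MEMO (R5b-α) (5)): per-depth signed terms ⇒ `ε₀ · (s₀q)^{(N−1)∕2} · Ψ` -/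

section Folding

variable {R : Type*} [Field R]

/-- **Swapping the bit flips the sign of the window value**: for `e ≤ 1`, `g e − g (1 − e) = (−1)^e · (g 0 − g 1)` (the partner `Ad_h t` flips every bit, B-p12 MEMO (4)).
[cite: LabesseLanglands1979, §2] -/
theorem apply_sub_apply_one_sub_eq_neg_one_pow_mul (g : ℕ → R) {e : ℕ} (he : e ≤ 1) : g e - g (1 - e) = (-1 : R) ^ e * (g 0 - g 1) := by
  rcases Nat.le_one_iff_eq_zero_or_eq_one.1 he with rfl | rfl
  · simp
  · simp

/-- **THE EXPONENT IDENTITY behind MEMO (5)** (`N` odd, `i ≤ N`, `q ≠ 0`; no use of `s₀² = 1` — both sides are the monomial `s₀^{2⌊i∕2⌋+d+1}q^d`, `d = (N−1)∕2 − ⌊i∕2⌋`):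
`s₀^{⌈(N+i)∕2⌉} · q^{⌊(N−i)∕2⌋} = s₀ · (s₀q)^{(N−1)∕2} · (s₀∕q)^{⌊i∕2⌋}`, with `⌈(N+i)∕2⌉ = (N + i + 1) ∕ 2` and all quotients in `ℕ`. [cite: LabesseLanglands1979, §2 (`δ_m = 2q^m`)] -/
theorem pow_ceil_mul_pow_floor_eq (s₀ q : R) (hq : q ≠ 0) {N i : ℕ} (hN : N % 2 = 1) (hi : i ≤ N) :
    s₀ ^ ((N + i + 1) / 2) * q ^ ((N - i) / 2) = s₀ * (s₀ * q) ^ ((N - 1) / 2) * (s₀ * q⁻¹) ^ (i / 2) := by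
  obtain ⟨r, rfl⟩ : ∃ r, N = 2 * r + 1 := ⟨N / 2, by omega⟩
  obtain ⟨j, hj⟩ : ∃ j, i = 2 * j + i % 2 := ⟨i / 2, by omega⟩
  have hi2 : i % 2 = 0 ∨ i % 2 = 1 := Nat.mod_two_eq_zero_or_one i
  have hjr : j ≤ r := by omega
  have e1 : (2 * r + 1 + i + 1) / 2 = r + j + 1 := by omega
  have e2 : (2 * r + 1 - i) / 2 = r - j := by omega
  have e3 : (2 * r + 1 - 1) / 2 = r := by omega
  have e4 : i / 2 = j := by omega
  rw [e1, e2, e3, e4]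
  obtain ⟨d, rfl⟩ := Nat.exists_eq_add_of_le hjr
  rw [Nat.add_sub_cancel_left]
  -- both sides are the monomial `s₀^{2j+d+1} q^{d}`; normalise with `q * q⁻¹ = 1`
  rw [mul_pow, mul_pow, inv_pow]
  have hqj : q ^ (j + d) = q ^ d * q ^ j := by rw [pow_add, mul_comm]
  rw [hqj]
  field_simp
  ring

/-- **THE FOLD** (MEMO (5), last equality): with signs `σ i = ε₀ · s₀^{⌈(N+i)∕2⌉}` and weights `2q^{⌊(N−i)∕2⌋}` on the window `i < m ≤ N + 1`,
`Σ_{i<m} 2q^{⌊(N−i)∕2⌋} · σ i · ψ i = ε₀ · (s₀q)^{(N−1)∕2} · (2s₀ · Σ_{i<m} (s₀∕q)^{⌊i∕2⌋} ψ i)` — the shape `ε t · b^{(N t−1)∕2} · Ψ t` of `exists_eventually_mul_eq_const_of_signedWindow`.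
[cite: LabesseLanglands1979, §2] [cite: Rogawski1990, §4.9 Lemma 4.9.3 (4.9.2) p. 56] -/
theorem sum_weight_mul_sign_mul_eq_signedWindow (s₀ q ε₀ : R) (hq : q ≠ 0) {N m : ℕ} (hN : N % 2 = 1) (hm : m ≤ N + 1)
    (σ ψ : ℕ → R) (hσ : ∀ i ∈ range m, σ i = ε₀ * s₀ ^ ((N + i + 1) / 2)) :
    ∑ i ∈ range m, (2 * q ^ ((N - i) / 2)) * (σ i * ψ i) = ε₀ * (s₀ * q) ^ ((N - 1) / 2) * (2 * s₀ * ∑ i ∈ range m, (s₀ * q⁻¹) ^ (i / 2) * ψ i) := by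
  rw [Finset.mul_sum, Finset.mul_sum]
  refine Finset.sum_congr rfl fun i hi => ?_
  have hiN : i ≤ N := by have := Finset.mem_range.1 hi; omega
  rw [hσ i hi]
  have key := pow_ceil_mul_pow_floor_eq s₀ q hq hN hiN
  calc 2 * q ^ ((N - i) / 2) * (ε₀ * s₀ ^ ((N + i + 1) / 2) * ψ i) = 2 * ε₀ * (s₀ ^ ((N + i + 1) / 2) * q ^ ((N - i) / 2)) * ψ i := by ring
    _ = 2 * ε₀ * (s₀ * (s₀ * q) ^ ((N - 1) / 2) * (s₀ * q⁻¹) ^ (i / 2)) * ψ i := by rw [key]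
    _ = ε₀ * (s₀ * q) ^ ((N - 1) / 2) * (2 * s₀ * ((s₀ * q⁻¹) ^ (i / 2) * ψ i)) := by ring

/-- **Splitting the window by parity of the depth** (edge piece `K` ↔ odd `i`, vertex piece `K♯` ↔ even `i` at `N` odd, MEMO (1)): a sum over `range m` is the sum of its odd-indexed
and even-indexed parts. [cite: LabesseLanglands1979, §2] -/
theorem sum_range_eq_sum_filter_odd_add_sum_filter_even (m : ℕ) (a : ℕ → R) :
    ∑ i ∈ range m, a i = ∑ i ∈ (range m).filter (fun i => i % 2 = 1), a i + ∑ i ∈ (range m).filter (fun i => i % 2 = 0), a i := by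
  rw [← Finset.sum_filter_add_sum_filter_not (range m) (fun i => i % 2 = 1) a]
  congr 1
  refine Finset.sum_congr ?_ fun _ _ => rfl
  ext i
  simp only [Finset.mem_filter]
  constructor
  · rintro ⟨h, h1⟩; exact ⟨h, by omega⟩
  · rintro ⟨h, h0⟩; exact ⟨h, by omega⟩

end Folding

/-! ## §4 (ED. 3) The PIECES fold: per-piece expansions at `t` (bits `e`) and at the partner (bits `1 − e`) ⇒ the signed window, then `ε · (s₀q)^{(N−1)∕2} · Ψ` -/

section PiecesFold

/-- **Deep parts cancel, window values pair up with a sign** (B-p12 MEMO (4)–(5); the shape of the (R5b-α) heads: per piece `k`,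
`O k = r_k • (A_k • φm_k + Σ_{i<m} c_k(i) • φ_k i (e_k i))` at `t` and `O′ k` = the same with the bits flipped `1 − e_k i` at the partner):
`Σ_k (O k − O′ k) = Σ_{i<m} Σ_k r_k · c_k(i) · (−1)^{e_k i} · (φ_k i 0 − φ_k i 1)` — abstract deep weights `A_k : ℕ` and window weights `c_k(i) : ℕ` (ℕ-scalar actions as in ★
`sum_sub_eq_depthExpansion_of_paritySums`). [cite: LabesseLanglands1979, §2] [cite: Rogawski1990, §4.9 Lemma 4.9.3 (4.9.2) p. 56] -/
theorem sum_sub_eq_sum_window_of_bitFlip {ι : Type*} [Fintype ι] (m : ℕ) (r : ι → ℝ) (A : ι → ℕ) (c : ι → ℕ → ℕ) (φm : ι → ℂ) (φ : ι → ℕ → ℕ → ℂ)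
    (e : ι → ℕ → ℕ) (he : ∀ k, ∀ i ∈ range m, e k i ≤ 1) (O O' : ι → ℂ)
    (hO : ∀ k, O k = r k • (A k • φm k + ∑ i ∈ range m, c k i • φ k i (e k i)))
    (hO' : ∀ k, O' k = r k • (A k • φm k + ∑ i ∈ range m, c k i • φ k i (1 - e k i))) :
    ∑ k, (O k - O' k) = ∑ i ∈ range m, ∑ k, (r k : ℂ) * (c k i : ℂ) * ((-1 : ℂ) ^ (e k i) * (φ k i 0 - φ k i 1)) := by
  have hk : ∀ k, O k - O' k = ∑ i ∈ range m, (r k : ℂ) * (c k i : ℂ) * ((-1 : ℂ) ^ (e k i) * (φ k i 0 - φ k i 1)) := by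
    intro k
    rw [hO k, hO' k, ← smul_sub, add_sub_add_left_eq_sub, ← Finset.sum_sub_distrib, Complex.real_smul, Finset.mul_sum]
    refine Finset.sum_congr rfl fun i hi => ?_
    rw [← smul_sub, ← apply_sub_apply_one_sub_eq_neg_one_pow_mul (φ k i) (he k i hi), nsmul_eq_mul]
    ring
  rw [Finset.sum_congr rfl fun k _ => hk k, Finset.sum_comm]

/-- **At an ODD depth the parity indicator of the window weights is `N`-free**: for `N` odd and `i ≤ N`, `(N − i) % 2 = p ↔ (i + 1) % 2 = p`. [cite: LabesseLanglands1979, §2] -/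
theorem sub_mod_two_eq_iff_of_odd {N i p : ℕ} (hN : N % 2 = 1) (hi : i ≤ N) : (N - i) % 2 = p ↔ (i + 1) % 2 = p := by
  constructor <;> intro h <;> omega

/-- **THE PIECES FOLD INTO THE SIGNED WINDOW** (MEMO (5), all pieces at once).  With window weights `c_k(i) = [i ≤ N ∧ (N − i) % 2 = par k]·2q^{(N−i)∕2}` (`par k` = the piece's
type: which parity of depths it sees), bits obeying the SIGN LAW `(−1)^{e_k i} = σ_k · ε · s₀^{(N+i+1)∕2}` (`σ_k = ±1` a piece constant, `ε` the angle sign, ★ FILE 5), `N` odd and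
`m ≤ N + 1`: `Σ_k (O k − O′ k) = ε · (s₀q)^{(N−1)∕2} · (2s₀ · Σ_{i<m} (s₀∕q)^{⌊i∕2⌋} · ψ i)` with the `N`-FREE window values `ψ i := Σ_k [(i+1) % 2 = par k]·r_k·σ_k·(φ_k i 0 − φ_k i 1)` —
the `hD` binder of ★ `exists_eventually_mul_eq_const_of_signedWindow` ∕ ★ `rankOneUnstable_core_of_signedWindow` (`b = s₀q`).
[cite: LabesseLanglands1979, §2] [cite: Rogawski1990, §4.9 Lemma 4.9.3 (4.9.2) p. 56] -/
theorem sum_sub_eq_signedWindow_of_bitFlip {ι : Type*} [Fintype ι] (q : ℕ) (hq : (q : ℂ) ≠ 0) (s₀ ε : ℂ) {m N : ℕ} (hN : N % 2 = 1) (hm : m ≤ N + 1)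
    (par : ι → ℕ) (σ : ι → ℂ) (r : ι → ℝ) (A : ι → ℕ) (φm : ι → ℂ) (φ : ι → ℕ → ℕ → ℂ) (e : ι → ℕ → ℕ) (he : ∀ k, ∀ i ∈ range m, e k i ≤ 1)
    (hsign : ∀ k, ∀ i ∈ range m, (N - i) % 2 = par k → (-1 : ℂ) ^ (e k i) = σ k * ε * s₀ ^ ((N + i + 1) / 2))
    (O O' : ι → ℂ)
    (hO : ∀ k, O k = r k • (A k • φm k + ∑ i ∈ range m, (if i ≤ N ∧ (N - i) % 2 = par k then 2 * q ^ ((N - i) / 2) else 0) • φ k i (e k i)))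
    (hO' : ∀ k, O' k = r k • (A k • φm k + ∑ i ∈ range m, (if i ≤ N ∧ (N - i) % 2 = par k then 2 * q ^ ((N - i) / 2) else 0) • φ k i (1 - e k i))) :
    ∑ k, (O k - O' k) =
      ε * (s₀ * q) ^ ((N - 1) / 2) * (2 * s₀ * ∑ i ∈ range m, (s₀ * (q : ℂ)⁻¹) ^ (i / 2) *
        ∑ k, (if (i + 1) % 2 = par k then (r k : ℂ) * σ k * (φ k i 0 - φ k i 1) else 0)) := by
  classical
  rw [sum_sub_eq_sum_window_of_bitFlip m r A _ φm φ e he O O' hO hO']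
  -- rewrite each window term into `2q^{(N−i)∕2} · (σ′ i · ψ i)` with `σ′ i := ε s₀^{(N+i+1)∕2}`
  rw [← sum_weight_mul_sign_mul_eq_signedWindow s₀ (q : ℂ) ε hq hN hm (fun i => ε * s₀ ^ ((N + i + 1) / 2)) _ (fun i _ => rfl)]
  refine Finset.sum_congr rfl fun i hi => ?_
  have hiN : i ≤ N := by have := Finset.mem_range.1 hi; omega
  rw [Finset.mul_sum, Finset.mul_sum]
  refine Finset.sum_congr rfl fun k _ => ?_
  by_cases hp : (N - i) % 2 = par k
  · have hp' : (i + 1) % 2 = par k := (sub_mod_two_eq_iff_of_odd hN hiN).1 hp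
    rw [if_pos ⟨hiN, hp⟩, if_pos hp', hsign k i hi hp]
    push_cast
    ring
  · have hp' : ¬ (i + 1) % 2 = par k := fun h => hp ((sub_mod_two_eq_iff_of_odd hN hiN).2 h)
    rw [if_neg (fun h => hp h.2), if_neg hp']
    push_cast
    ring

end PiecesFold

/-! ## §5 (ED. 4) The pieces fold with ABSTRACT window weights (each piece's literal `if`-weights discharged by two pointwise laws) -/

section PiecesFoldWeights

/-- **THE PIECES FOLD, WEIGHT-AGNOSTIC FORM.**  As `sum_sub_eq_signedWindow_of_bitFlip`, but the window weights `c k i : ℕ` are abstract and pinned only ON THE WINDOW by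
`hc : (N − i) % 2 = par k → c k i = 2q^{(N−i)∕2}` and `hc' : (N − i) % 2 ≠ par k → c k i = 0` for `i < m` — so the EDGE head's literal
`if i ≤ N ∧ (N − i) % 2 = 0 then (if N − i = 0 then 1 else 2q^{(N−i)∕2}) else 0` (★ α4, A-p13 (g32)) and the VERTEX head's `if i ≤ N ∧ (N − i) % 2 = 1 then 2q^{(N−i)∕2} else 0` (A-p03 (g26) V2)
are both consumed after a two-line `split_ifs` (on the window `i < m ≤ N`, so `i ≤ N` and `N − i ≠ 0`). [cite: LabesseLanglands1979, §2] [cite: Rogawski1990, §4.9 Lemma 4.9.3 (4.9.2) p. 56] -/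
theorem sum_sub_eq_signedWindow_of_bitFlip_of_weights {ι : Type*} [Fintype ι] (q : ℕ) (hq : (q : ℂ) ≠ 0) (s₀ ε : ℂ) {m N : ℕ} (hN : N % 2 = 1) (hm : m ≤ N + 1)
    (par : ι → ℕ) (σ : ι → ℂ) (r : ι → ℝ) (A : ι → ℕ) (c : ι → ℕ → ℕ) (φm : ι → ℂ) (φ : ι → ℕ → ℕ → ℂ) (e : ι → ℕ → ℕ) (he : ∀ k, ∀ i ∈ range m, e k i ≤ 1)
    (hc : ∀ k, ∀ i ∈ range m, (N - i) % 2 = par k → c k i = 2 * q ^ ((N - i) / 2))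
    (hc' : ∀ k, ∀ i ∈ range m, ¬ (N - i) % 2 = par k → c k i = 0)
    (hsign : ∀ k, ∀ i ∈ range m, (N - i) % 2 = par k → (-1 : ℂ) ^ (e k i) = σ k * ε * s₀ ^ ((N + i + 1) / 2))
    (O O' : ι → ℂ)
    (hO : ∀ k, O k = r k • (A k • φm k + ∑ i ∈ range m, c k i • φ k i (e k i)))
    (hO' : ∀ k, O' k = r k • (A k • φm k + ∑ i ∈ range m, c k i • φ k i (1 - e k i))) :
    ∑ k, (O k - O' k) =
      ε * (s₀ * q) ^ ((N - 1) / 2) * (2 * s₀ * ∑ i ∈ range m, (s₀ * (q : ℂ)⁻¹) ^ (i / 2) *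
        ∑ k, (if (i + 1) % 2 = par k then (r k : ℂ) * σ k * (φ k i 0 - φ k i 1) else 0)) := by
  classical
  -- replace the abstract weights by the `if`-weights of `sum_sub_eq_signedWindow_of_bitFlip` inside `hO`, `hO'`
  have hcw : ∀ k, ∀ i ∈ range m, c k i = (if i ≤ N ∧ (N - i) % 2 = par k then 2 * q ^ ((N - i) / 2) else 0) := by
    intro k i hi
    have hiN : i ≤ N := by have := Finset.mem_range.1 hi; omega
    by_cases hp : (N - i) % 2 = par k
    · rw [if_pos ⟨hiN, hp⟩, hc k i hi hp]
    · rw [if_neg (fun h => hp h.2), hc' k i hi hp]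
  refine sum_sub_eq_signedWindow_of_bitFlip q hq s₀ ε hN hm par σ r A φm φ e he hsign O O' (fun k => ?_) (fun k => ?_)
  · rw [hO k, Finset.sum_congr rfl fun i hi => by rw [hcw k i hi]]
  · rw [hO' k, Finset.sum_congr rfl fun i hi => by rw [hcw k i hi]]

end PiecesFoldWeights

end Literature.NumberTheory.Rogawski1990
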